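import Mathlib
import HarnessLib
import Summits.ResolutionOfSingularities.ResolutionOfSingularities.Theorems.WildQuotientsWildQuotientResolutionS1aRingKillDataOfCert

/-!
# S1a — THE A-SIDE RING ANALOGUE: after an ADMISSIBLE move the augmentation ideal upstairs is `(β s) · 𝔞`, `𝔞 = (augIdeal σ_R : β s)` the residual ideal

[OURS · L1 W4.5c · lead-1 g10; SUCCESSOR-BRIEF v1.3 §4 item 3 «under (H1) alone, augIdeal σʼ = (βs)·𝔞R_b … the bad locus upstairs over the chart is V(𝔞R_b)»]
— NOT statements of the manuscript; counted 0; AI-level work, weaker than expert review. Crux stmt-ResolutionOfSingularities-17941 `CyclicQuotientFourfolds`,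
line `s1a-logminvertex` v10, A-side (`stub_auxWithinReachAux`; the census' successor rule «children = zeros of the shifted initial forms on E₊»).
Route-independent; pure algebra.

* `eq_span_mul_colon_of_le` — an ideal inside a principal ideal factors through its colon: `I ≤ (g) ⇒ I = (g) · (I : g)`;
* ★ `augmentationIdeal_sigmaR_eq_span_mul_colon` — (H1) `augIdeal σ_R ≤ (g)` ⇒ `augIdeal σ_R = (g) · 𝔞`, `𝔞 := (augIdeal σ_R : g)`;
* ★★ `augmentationIdeal_sigmaChart_eq_span_mul_map_colon` — … and on EVERY σ-fixed chart `R_b = R^w[(bT^d)⁻¹]`: `augIdeal σʼ = (g) · 𝔞R_b`. So after a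
  boundary-admissible move (`g = β s`, (a′) ⇒ (H1) by `augmentationIdeal_sigmaR_le_span_of_admissible`, p636398) the exceptional divisor joins the boundary with
  multiplicity ≥ 1 and the fixed-point ideal upstairs is the new boundary `β s` times the RESIDUAL `𝔞R_b`; off `V(𝔞R_b)` the chart is killed
  (`augmentationIdeal_sigmaChart_eq_span_of_unit_mem_colon`: `= (g)` as soon as some element of `𝔞` is a unit), i.e. the bad locus upstairs over the chart lies in
  `V(𝔞 R_b)` — for a kill `𝔞 ⊇ vertexIdeal^N` is irrelevant on `B₊` (KC3), for an aux move `V(𝔞) ∩ E₊ = V(IN_w θ) ∩ E₊` carries the next centres;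
* `augmentationIdeal_sigmaChart_eq_of_admissible` — the same with `g = β s` from (a′) directly.
-/

set_option linter.dupNamespace false

noncomputable section

open Literature.AlgebraicGeometry.Resolution
open scoped LaurentPolynomial
open Summit.ResolutionOfSingularities.ResolutionOfSingularities.Theorems.WildQuotientResolution.S1.CoarseChart

namespace Summit.ResolutionOfSingularities.ResolutionOfSingularities.Theorems.WildQuotientResolution.S1.KillCert

universe u v

/-- **An ideal inside a principal ideal factors through its colon**: `I ≤ (g) ⇒ I = (g) · (I : g)`. [folklore] -/
theorem eq_span_mul_colon_of_le {R : Type u} [CommRing R] {I : Ideal R} {g : R} (h : I ≤ Ideal.span {g}) :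
    I = Ideal.span {g} * I.colon (Ideal.span {g}) := by
  apply le_antisymm
  · intro x hx
    obtain ⟨a, rfl⟩ := Ideal.mem_span_singleton'.mp (h hx)
    have e : a * g = g * a := mul_comm a g
    rw [e]
    exact Ideal.mul_mem_mul (Ideal.mem_span_singleton_self g) (Ideal.mem_colon_span_singleton.mpr hx)
  · rw [Ideal.mul_le]
    intro r hr a ha
    obtain ⟨r', rfl⟩ := Ideal.mem_span_singleton'.mp hr
    rw [mul_assoc, mul_comm g a]
    exact Ideal.mul_mem_left _ _ (Ideal.mem_colon_span_singleton.mp ha)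

section Residual

variable {B : Type u} [CommRing B] {c : ℕ} (f : Fin c → B) (w : Fin c → ℕ) (σ : B ≃+* B)
  (hσJ : ∀ n : ℕ, ((weightedFiltration f w).ideal n).map (σ : B →+* B) ≤ (weightedFiltration f w).ideal n)
  {p : ℕ} (hp : 0 < p) (hσp : ∀ x : B, (⇑σ)^[p] x = x)

/-- ★ **(H1) ⇒ `augIdeal σ_R = (g) · 𝔞`** with the RESIDUAL ideal `𝔞 := (augIdeal σ_R : g)`. [OURS · L1 W4.5c] -/
theorem augmentationIdeal_sigmaR_eq_span_mul_colon {g : ↥(cobordantAlgebra f w)}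
    (h1 : augmentationIdeal (sigmaR σ f w hσJ hp hσp) ≤ Ideal.span {g}) :
    augmentationIdeal (sigmaR σ f w hσJ hp hσp) =
      Ideal.span {g} * (augmentationIdeal (sigmaR σ f w hσJ hp hσp)).colon (Ideal.span {g}) :=
  eq_span_mul_colon_of_le h1

/-- ★★ **THE A-SIDE RING ANALOGUE.** Under (H1) alone, on EVERY σ-fixed chart `R_b = R^w[(b T^d)⁻¹]` the augmentation ideal of `σʼ` is the product
`(g) · 𝔞R_b` of the principal ideal `(g)` and the extension of the residual ideal `𝔞 = (augIdeal σ_R : g)` (augmentation ideals commute with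
localisation, p635979). For `g = β s`: the fixed-point ideal upstairs = (old boundary × exceptional divisor) · residual. [OURS · L1 W4.5c · SUCCESSOR-BRIEF
v1.3 §4 item 3; NOT a statement of the manuscript] -/
theorem augmentationIdeal_sigmaChart_eq_span_mul_map_colon {ι : Type v} [AddCommGroup ι] [DecidableEq ι] (𝒜 : ι → AddSubgroup B)
    [GradedRing 𝒜] {d : ℕ} (b : ↥(𝒜 0)) (hb : b ∈ (traceFiltration 𝒜 f w).ideal d) (hσb : σ (b : B) = b)
    {g : ↥(cobordantAlgebra f w)} (h1 : augmentationIdeal (sigmaR σ f w hσJ hp hσp) ≤ Ideal.span {g}) :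
    augmentationIdeal (sigmaChart 𝒜 f w d b hb σ hσJ hp hσp hσb) =
      Ideal.span {algebraMap _ (ChartRing 𝒜 f w d b hb) g} *
        ((augmentationIdeal (sigmaR σ f w hσJ hp hσp)).colon (Ideal.span {g})).map (algebraMap _ (ChartRing 𝒜 f w d b hb)) := by
  rw [augmentationIdeal_sigmaChart_eq_map]
  conv_lhs => rw [augmentationIdeal_sigmaR_eq_span_mul_colon f w σ hσJ hp hσp h1]
  rw [Ideal.map_mul, Ideal.map_span, Set.image_singleton]

/-- **Off the residual locus the chart is killed**: under (H1), after inverting (the image of) any element `a ∈ 𝔞` — i.e. on the open `D(a)` of the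
chart — the augmentation ideal of the further-localised automorphism is principal, generated by `g`. Stated ring-theoretically: if the image of some
`a ∈ 𝔞` is a unit of the chart ring itself, `augIdeal σʼ = (g)`. [OURS · L1 W4.5c] -/
theorem augmentationIdeal_sigmaChart_eq_span_of_unit_mem_colon {ι : Type v} [AddCommGroup ι] [DecidableEq ι] (𝒜 : ι → AddSubgroup B)
    [GradedRing 𝒜] {d : ℕ} (b : ↥(𝒜 0)) (hb : b ∈ (traceFiltration 𝒜 f w).ideal d) (hσb : σ (b : B) = b)
    {g : ↥(cobordantAlgebra f w)} (h1 : augmentationIdeal (sigmaR σ f w hσJ hp hσp) ≤ Ideal.span {g})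
    {a : ↥(cobordantAlgebra f w)} (ha : a ∈ (augmentationIdeal (sigmaR σ f w hσJ hp hσp)).colon (Ideal.span {g}))
    (hunit : IsUnit (algebraMap _ (ChartRing 𝒜 f w d b hb) a)) :
    augmentationIdeal (sigmaChart 𝒜 f w d b hb σ hσJ hp hσp hσb) = Ideal.span {algebraMap _ (ChartRing 𝒜 f w d b hb) g} := by
  rw [augmentationIdeal_sigmaChart_eq_span_mul_map_colon f w σ hσJ hp hσp 𝒜 b hb hσb h1]
  have htop : ((augmentationIdeal (sigmaR σ f w hσJ hp hσp)).colon (Ideal.span {g})).map (algebraMap _ (ChartRing 𝒜 f w d b hb)) = ⊤ :=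
    Ideal.eq_top_of_isUnit_mem _ (Ideal.mem_map_of_mem _ ha) hunit
  rw [htop, Ideal.mul_top]

/-- **The boundary-admissible case** (`g = β s`): (a′) `y ∈ 𝒥ₙ ⇒ σ y − y ∈ β 𝒥ₙ₊₁` gives, on every σ-fixed chart,
`augIdeal σʼ = (β s) · (augIdeal σ_R : β s) R_b` — the census' successor rule «new bad locus ⊆ V(residual) on E₊ ∪ strict transforms» at the ring
level. [OURS · L1 W4.5c; NOT a statement of the manuscript] -/
theorem augmentationIdeal_sigmaChart_eq_of_admissible {ι : Type v} [AddCommGroup ι] [DecidableEq ι] (𝒜 : ι → AddSubgroup B)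
    [GradedRing 𝒜] {d : ℕ} (b : ↥(𝒜 0)) (hb : b ∈ (traceFiltration 𝒜 f w).ideal d) (hσb : σ (b : B) = b) (β : B)
    (hadm : ∀ (n : ℕ) (y : B), y ∈ (weightedFiltration f w).ideal n →
      σ y - y ∈ Ideal.span {β} * (weightedFiltration f w).ideal (n + 1)) :
    augmentationIdeal (sigmaChart 𝒜 f w d b hb σ hσJ hp hσp hσb) =
      Ideal.span {algebraMap _ (ChartRing 𝒜 f w d b hb) (algebraMap B (↥(cobordantAlgebra f w)) β * cobordantAlgebra.s f w)} *
        ((augmentationIdeal (sigmaR σ f w hσJ hp hσp)).colon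
          (Ideal.span {algebraMap B (↥(cobordantAlgebra f w)) β * cobordantAlgebra.s f w})).map (algebraMap _ (ChartRing 𝒜 f w d b hb)) :=
  augmentationIdeal_sigmaChart_eq_span_mul_map_colon f w σ hσJ hp hσp 𝒜 b hb hσb
    (augmentationIdeal_sigmaR_le_span_of_admissible f w σ hσJ hp hσp β hadm)

end Residual

end Summit.ResolutionOfSingularities.ResolutionOfSingularities.Theorems.WildQuotientResolution.S1.KillCert

end
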